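import Literature.AnabelianGeometry.EtaleTheta.LogDivisorModelZTower
import Literature.AnabelianGeometry.EtaleTheta.TemperedFrobenioidOfDiagonalBase
import Literature.AnabelianGeometry.EtaleTheta.BiKummerThm44HypOfGaloisCoveringTempered
import HarnessLib

/-!
# [EtTh] Def. 3.6 (ii) / Def. 4.1: the tempered Frobenioid of the ℤ-TOWER over the genuine connected base `B^temp(Π^tp_X)⁰` —
# `Φ₀(Π/H) ≅ ∏_{ℤ/φ(H)} ℤ_{≥0}`, RANK > 1, Def. 3.6 (ii)(a) PROPER (class (b) NV)

S. Mochizuki, *The étale theta function …*, Publ. RIMS **45** (2009) [MochizukiEtTh2009], §1 p.12 (the universal combinatorial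
covering of a Tate curve: an infinite chain of projective lines, Galois group `ℤ` acting by translation), Def. 3.3 (iii) p.73,
Def. 3.6 (ii) p.76–77, Def. 4.1 p.86 [cite: MochizukiEtTh2009, Def 3.6 p.77]; [FrdI] Thm. 5.2 (ii) p.100; [FrdII] Ex. 1.3 p.11.

abc-iut cell, layer L2 [EtTh], seat abc-iut-w5-d179 (gen 6), L2-lead row R505 «ℤ-TOWER TEMPERED FROBENIOID OVER THE FULL TEMPERED
BASE», FILE 3 of 3 (part A).  Every tempered Frobenioid over CONSTRUCTED Def. 3.3 (iii) data in the tree so far is RANK ONE at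
every covering (`OneCompTempered.*`, abc-iut-w6-d048 p452830: trivial action on the one-component model; the rank-one
points / Tate-tower rank-one engines), so Def. 3.6 (ii)(a) «`Φ^{bs-fld} := Φ ∩ ℝ·Φ₀^cnst` monoprime» only ever held as
`Φ^{bs-fld} = Φ`.  THIS FILE: for EVERY tempered arithmetic group `X` (field `K : Type`) and EVERY character
`φ : Π^tp_X →* ℤ` (through which `Π^tp_X` translates the chain of components of the Tate tower skeleton — print's
`Π^tp_X ↠ Gal(Z^log_∞/X^log) = ℤ`):
* `ZTowerTempered.dm X φ` — the Def. 3.3 (iii) data `ofGaloisActionCosetCat X.isTempered (ZTower.action φ) TateTower.cuspLaws` over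
  the small model `CosetCat Π^tp_X ≌ B^temp(Π^tp_X)⁰` of print's `D₀`: at the covering `Π/H`, `Φ₀(Π/H) = Hom_Π(Π/H, Div⁺(Z_∞))`
  = the `φ(H)`-periodic effective divisors on the chain `≅ ∏_{ℤ/φ(H)} ℤ_{≥0}` — ONE component over `X` itself when `φ` is
  onto, `[ℤ : φ(H)]` components over `Π/H`, INFINITELY many over `H ≤ ker φ` (the `Z_∞`-like objects; weak vocabulary F-L2d2-1);
* `ZTowerTempered.diagonalBase X φ` — abc-iut-w5-d179's `TemperedFrobenioid.DiagonalBase` (FILE 2, `TemperedFrobenioidOfDiagonalBase`)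
  along the EQUIVALENCE `B^temp(Π^tp_X)⁰ ⥤ CosetCat Π^tp_X`: coordinates `ZTower.coord`, diagonal `ZTower.diag` (= `div ϖ`),
  `Φ₀^cnst = ⟨[diag]⟩` (`ZTower.divZeroHom_mem_zpowers_of_mem_fZero`, FILE 1 p460567), pull-backs injective / reflecting
  (abc-iut-w6-d048's `ofGaloisActionCosetCat_Φ₀_map_injective/_reflects_dvd`);
* **`ZTowerTempered.temperedFrobenioid X φ R S`** := `TemperedFrobenioid.ofDiagonalBase …` — Def. 3.6 (ii) data of monoid type `ℤ`
  over `B^temp(Π^tp_X)⁰` with `Φ := im(Φ₀^pf → Φ₀^rlf)`, EVERY clause proved, **(a) `Φ^{bs-fld}(A) = ι(⟨diag⟩^pf) ≅ ℚ_{≥0}`**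
  (`temperedFrobenioid_bsFld_carrier`), (b) `div ϖ = ι(diag) ≠ 1`; it IS a Frobenioid (`isFrobenioid_temperedFrobenioid`);
  `baseShape` with `𝒟 := Π/Π`, `hBD`, `hP` — the inputs of abc-iut-L2-t4's `BiKummerSetting.mkOfConnectedTemperoid`;
* `ZTowerTempered.setting X φ R S NH M` — the §4 bi-Kummer setting over these data (`A_⊙ := (Π^tp_X/M, 0)`).
The `Thm44Hyp` record (whose `isNonDilating` slots quantify over ALL endomorphisms: translations of the coordinates) and the
Thm. 4.4 closers are part B (`BiKummerThm44HypOfGaloisCoveringZTower.lean`).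
HONEST FRAMING: class (b) construction; the Tate tower skeleton is a combinatorial model (not a formal scheme), `φ` is a
parameter (print's is the quotient by the geometric tempered fundamental group of the special fibre's dual graph);
`LogDivisorModel` / `GaloisAction` / `TemperedArithmeticGroup` are interface records; 3 defs (`diagonalBase`, `temperedFrobenioid`,
`setting`) + 2 abbrevs (`dm`, `gset`), no Prop fact, no instance, no sorry; nothing here bears on [IUTchIII] Cor. 3.12; typed ≠ proved.
-/

noncomputable section

namespace Literature.AnabelianGeometry.EtaleTheta

open CategoryTheory Opposite Function Literature.AlgebraicGeometry.Frobenioids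
  Literature.AnabelianGeometry.SemiGraphs LogDivisorModel LogDivisorModel.GaloisAction

namespace ZTowerTempered

variable {K : Type} [Field K] (X : SemiGraphs.TemperedArithmeticGroup.{0} K) (φ : X.Pi →* Multiplicative ℤ)

/-- **The Def. 3.3 (iii) data of the ℤ-tower**: `Π^tp_X` translating the Tate tower skeleton through `φ`, over the small model
`CosetCat Π^tp_X` of `B^temp(Π^tp_X)⁰`. [cite: MochizukiEtTh2009, Def 3.3 p.73] -/
abbrev dm : DivisorMonoids.{0, 0, 0} (CosetCat X.Pi) :=
  DivisorMonoids.ofGaloisActionCosetCat X.isTempered (ZTower.action φ) TateTower.cuspLaws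

/-- Prop. 3.4 (i) (weak, cofinal perfection) at every `Φ₀(Π/H)` — the `hpf` slot (abc-iut-w6-d048).
[cite: MochizukiEtTh2009, Prop 3.4 p.74] -/
theorem hpf : ∀ Y : (CosetCat X.Pi)ᵒᵖ, IsPerfFactorialCof ((dm X φ).Φ₀.obj Y) :=
  fun Y => DivisorMonoids.ofGaloisActionCosetCat_isPerfFactorialCof X.isTempered _ _ Y

/-- The `Π^tp_X`-set `Π/H` underlying a connected tempered covering `A` (through the equivalence `B^temp(Π)⁰ ⥤ CosetCat Π`).
[cite: MochizukiFrdII2008, Ex 1.3 (i) p.11] -/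
abbrev gset (A : ConnectedPart (BTemp X.Pi)) : Action (Type 0) X.Pi :=
  ((CosetCat.toBTemp X.isTempered).obj ((OneCompTempered.equiv X).inverse.obj A)).obj

/-- `gset A` is connected (one orbit, nonempty). [cite: MochizukiFrdII2008, Ex 1.3 (ii) p.11] -/
theorem isConnectedGSet_gset (A : ConnectedPart (BTemp X.Pi)) : isConnectedGSet (gset X A) :=
  OneCompTempered.isConnectedGSet_toBTemp X _

/-- **Diagonal base data of the ℤ-tower along the equivalence `B^temp(Π^tp_X)⁰ ⥤ CosetCat Π^tp_X`**: coordinates = multiplicities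
`ZTower.coord (s, n)`, diagonal = `ZTower.diag` (`div ϖ`), `Φ₀^cnst = ⟨[diag]⟩`. [cite: MochizukiEtTh2009, Def 3.6 p.77] -/
def diagonalBase : TemperedFrobenioid.DiagonalBase (dm X φ) (ConnectedPart (BTemp X.Pi)) where
  F := (OneCompTempered.equiv X).inverse
  I A := (gset X A).V × ℤ
  i₀ A := ((isConnectedGSet_gset X A).1.some, 0)
  κ A i := ZTower.coord φ (gset X A) i.1 i.2
  d A := ZTower.diag φ (gset X A)
  κ_d A i := ZTower.coord_diag φ (gset X A) i.1 i.2
  eq_pow_of_κ_eq A _ _ h := ZTower.eq_diag_pow_of_coord_eq φ (gset X A) fun s n => h (s, n)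
  div₀_mem_zpowers A _ hb := ZTower.divZeroHom_mem_zpowers_of_mem_fZero φ (isConnectedGSet_gset X A) hb
  exists_div₀_eq A := ⟨ZTower.cnstFn φ (gset X A) 1, ZTower.cnstFn_mem_fZero φ _ 1, ZTower.divZeroHom_cnstFn_one φ _⟩
  hΦinj _ := DivisorMonoids.ofGaloisActionCosetCat_Φ₀_map_injective X.isTempered _ _ _
  hΦrefl _ a b h := DivisorMonoids.ofGaloisActionCosetCat_Φ₀_map_reflects_dvd X.isTempered _ _ _ a b h

/-- The base functor of the data is the equivalence inverse. [cite: MochizukiEtTh2009, Def 3.6 p.77] -/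
@[simp] theorem diagonalBase_F : (diagonalBase X φ).F = (OneCompTempered.equiv X).inverse := rfl

/-- The diagonal of the data at `A` is `ZTower.diag`. [cite: MochizukiEtTh2009, Def 3.6 p.77] -/
@[simp] theorem diagonalBase_d (A : ConnectedPart (BTemp X.Pi)) : (diagonalBase X φ).d A = ZTower.diag φ (gset X A) := rfl

variable (R S : ((ConnectedPart (BTemp X.Pi))ᵒᵖ ⥤ CommMonCat.{0}) → Prop)

/-- **The tempered Frobenioid of the ℤ-tower over the GENUINE base `B^temp(Π^tp_X)⁰`** (abc-iut-w5-d179's higher-rank engine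
`TemperedFrobenioid.ofDiagonalBase`): monoid type `ℤ`, `Φ := im(Φ₀^pf → Φ₀^rlf)`, every Def. 3.6 (ii) clause proved.
[cite: MochizukiEtTh2009, Def 3.6 p.77] -/
def temperedFrobenioid :
    TemperedFrobenioid (RealifiedDivisorMonoids.ofRlfZWeak (dm X φ) (hpf X φ)) (ConnectedPart (BTemp X.Pi))
      (treeCatVocab (ConnectedPart (BTemp X.Pi)) R S) :=
  TemperedFrobenioid.ofDiagonalBase (hpf X φ) (diagonalBase X φ) QuasiTemperoid.BTempConnected.connectedPart_isConnected
    QuasiTemperoid.BTempConnected.connectedPart_isTotallyEpimorphic QuasiTemperoid.BTempConnected.connectedPart_isOfFSMType R S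

/-- Its base functor IS the equivalence inverse `B^temp(Π^tp_X)⁰ ⥤ CosetCat Π^tp_X`. [cite: MochizukiEtTh2009, Def 3.6 p.77] -/
theorem temperedFrobenioid_base : (temperedFrobenioid X φ R S).base = (OneCompTempered.equiv X).inverse := rfl

/-- `Φ(A) = im(Φ₀(Π/H)^pf → Φ₀(Π/H)^rlf)`. [cite: MochizukiEtTh2009, Def 3.6 p.77] -/
theorem temperedFrobenioid_Φ_carrier (A : (ConnectedPart (BTemp X.Pi))ᵒᵖ) :
    (temperedFrobenioid X φ R S).Φ.carrier A = (diagonalBase X φ).pfImage (hpf X φ) A := rfl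

/-- **Def. 3.6 (ii)(a) WITH CONTENT: `Φ^{bs-fld}(A) = ι(⟨diag⟩^pf)`** — the roots of the powers of the reduced special fibre, a
monoprime submonoid of `Φ(A) ≅ (∏_{ℤ/φ(H)} ℤ_{≥0})^pf`. [cite: MochizukiEtTh2009, Def 3.6 p.77] -/
theorem temperedFrobenioid_bsFld_carrier (A : (ConnectedPart (BTemp X.Pi))ᵒᵖ) :
    (temperedFrobenioid X φ R S).bsFld.carrier A = (diagonalBase X φ).diagImage (hpf X φ) A :=
  TemperedFrobenioid.ofDiagonalBase_bsFld_carrier (hpf X φ) (diagonalBase X φ) _ _ _ R S A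

/-- The base functor is full. [cite: MochizukiEtTh2009, Def 4.1 p.86] -/
theorem temperedFrobenioid_base_full : (temperedFrobenioid X φ R S).base.Full := by
  rw [temperedFrobenioid_base]; infer_instance

/-- The base functor is faithful. [cite: MochizukiEtTh2009, Def 4.1 p.86] -/
theorem temperedFrobenioid_base_faithful : (temperedFrobenioid X φ R S).base.Faithful := by
  rw [temperedFrobenioid_base]; infer_instance

/-- **`baseShape`**: `D = D₀[𝒟]` with `𝒟 := Π^tp_X/Π^tp_X` — every object of `CosetCat Π^tp_X` is in the essential image and maps to
`CosetCat.top`. [cite: MochizukiEtTh2009, Def 4.1 p.86] -/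
theorem baseShape : (temperedFrobenioid X φ R S).base.Full ∧ (temperedFrobenioid X φ R S).base.Faithful ∧
    ∃ 𝒟 : CosetCat X.Pi, ∀ Y : CosetCat X.Pi,
      (∃ A : ConnectedPart (BTemp X.Pi), Nonempty ((temperedFrobenioid X φ R S).base.obj A ≅ Y)) ↔ Nonempty (Y ⟶ 𝒟) :=
  ⟨temperedFrobenioid_base_full X φ R S, temperedFrobenioid_base_faithful X φ R S, CosetCat.top, fun Y =>
    ⟨fun _ => ⟨CosetCat.toTop Y⟩, fun _ =>
      ⟨(OneCompTempered.equiv X).functor.obj Y, ⟨((OneCompTempered.equiv X).unitIso.app Y).symm⟩⟩⟩⟩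

/-- `hBD`: the `B₀`-pull-backs along base images are injective (abc-iut-w6-d048's one-liner). [cite: MochizukiEtTh2009, Def 3.6 p.76] -/
theorem hBD {A B : ConnectedPart (BTemp X.Pi)} (α : B ⟶ A) :
    Injective ((RealifiedDivisorMonoids.ofRlfZWeak (dm X φ) (hpf X φ)).BΛ.map ((temperedFrobenioid X φ R S).base.map α).op).hom :=
  DivisorMonoids.ofGaloisActionCosetCat_B₀_map_injective X.isTempered _ _ _

/-- **The ℤ-tower model IS a Frobenioid** ([FrdI] Thm. 5.2 (ii)). [cite: MochizukiFrdI2008, Thm. 5.2 (ii) p.100] -/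
theorem isFrobenioid_temperedFrobenioid : PreFrobenioid.IsFrobenioid (temperedFrobenioid X φ R S).toElem :=
  TemperedFrobenioid.isFrobenioid_ofDiagonalBase (hpf X φ) (diagonalBase X φ) _ _ _ R S
    fun g => DivisorMonoids.ofGaloisActionCosetCat_B₀_map_injective X.isTempered _ _ g

/-- `Φ(A)` is perfect — the `hP` slot. [cite: MochizukiEtTh2009, Def 4.1 p.86] -/
theorem hP (A : (ConnectedPart (BTemp X.Pi))ᵒᵖ) : IsPerfect ((temperedFrobenioid X φ R S).Φ.carrier A) :=
  TemperedFrobenioid.ofDiagonalBase_isPerfect (hpf X φ) (diagonalBase X φ) _ _ _ R S A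

/-- **`Φ` is non-dilating along every endomorphism pulling `Φ₀` back identically** (e.g. deck transformations translating by an
element of `φ(H)`; all of them when `φ = 1`). [cite: MochizukiFrdI2008, Def. 1.1 (i) p.19] -/
theorem isNonDilating_of_trivial (A : (ConnectedPart (BTemp X.Pi))ᵒᵖ) (α : A ⟶ A)
    (hid : ∀ m : (dm X φ).Φ₀.obj (op ((OneCompTempered.equiv X).inverse.obj A.unop)),
      ((dm X φ).Φ₀.map ((OneCompTempered.equiv X).inverse.map α.unop).op).hom m = m) :
    treeMonoidVocabWeak.{0}.IsNonDilating ((temperedFrobenioid X φ R S).Φ.carrier A) ((temperedFrobenioid X φ R S).Φ.pull α) :=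
  TemperedFrobenioid.isNonDilating_ofDiagonalBase_of_trivial (hpf X φ) (diagonalBase X φ) _ _ _ R S A α hid

variable (NH : Subgroup (Field.absoluteGaloisGroup K) → (temperedFrobenioid X φ R S).category → ℕ+ → Prop)
  (M : OpenNormalSubgroup X.Pi)

/-- **The §4 bi-Kummer setting over the ℤ-tower data at the genuine connected base** (abc-iut-L2-t4's `mkOfConnectedTemperoid`;
`A_⊙ := (Π^tp_X/M, 0)`). [cite: MochizukiEtTh2009, Def 4.1 p.86] -/
def setting : BiKummerSetting X (RealifiedDivisorMonoids.ofRlfZWeak (dm X φ) (hpf X φ)) (ConnectedPart (BTemp X.Pi))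
    (treeCatVocab (ConnectedPart (BTemp X.Pi)) R S) :=
  BiKummerSetting.mkOfConnectedTemperoid X (temperedFrobenioid X φ R S) rfl (hP X φ R S) NH
    ((temperedFrobenioid X φ R S).connQuotZeroObj M) ((temperedFrobenioid X φ R S).isFrobeniusTrivial_connQuotZeroObj M)
    ((temperedFrobenioid X φ R S).isGaloisObj_connQuotZeroObj_base M)

/-- **Non-vacuity**: the ℤ-tower tempered Frobenioid and its §4 setting exist for every `X`, `φ`, `R`, `S`, `NH`, `M`.
[cite: MochizukiEtTh2009, Def 4.1 p.86] -/
theorem nonempty_setting (NH : Subgroup (Field.absoluteGaloisGroup K) → (temperedFrobenioid X φ R S).category → ℕ+ → Prop)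
    (M : OpenNormalSubgroup X.Pi) :
    Nonempty (BiKummerSetting X (RealifiedDivisorMonoids.ofRlfZWeak (dm X φ) (hpf X φ)) (ConnectedPart (BTemp X.Pi))
      (treeCatVocab (ConnectedPart (BTemp X.Pi)) R S)) :=
  ⟨setting X φ R S NH M⟩

end ZTowerTempered

end Literature.AnabelianGeometry.EtaleTheta

end
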